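import Summits.BirchSwinnertonDyer.BirchSwinnertonDyer.Theorems.ThetaPartnerAtTwoSignedMainConjectureCMTwoRankZeroFlatOfCuspSpan
import Summits.BirchSwinnertonDyer.BirchSwinnertonDyer.Theorems.ResidualThetaTransportAtTwoThetaLayerLambdaCongruenceAtTwoCuspSpanRowInductionOdd
import Summits.BirchSwinnertonDyer.BirchSwinnertonDyer.Theorems.ResidualThetaTransportAtTwoCuspSpanDefs
import HarnessLib

/-!
# Route `ThetaPartnerAtTwo` (TP2), crux K2r0P `SignedMainConjectureCMTwoRankZeroOfPub` (stmt-BirchSwinnertonDyer-24945), line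
# `rankzero` v15 (8cf97eb87d24241a) — the registered stub `stub_analyticMuFlatNonUnitCMTwo` ((μ♭)_A = FLAT) PROVED, by name and signature

Cell `bsd-wall`, width seat `bsd-wall-tp2-p2-w4` (g8) of the `tp2-p2` lineage (lead g11 registered v15 = FLAT ∧ KZ). Theorem only; no
definition, no named fact, no instance, no `sorry`. It closes the FIRST of the two registered stubs of the skeleton of record of item 24945;
the item itself is NOT closed by this file (the second stub `stub_zetaErlKSideCMTwo` = KZ is a published input — Kato 2004 §12/§15 + JLK 2011
for the CM form at `2` — awaiting the route pen's HOLD item); BSD is NOT proved by any of this.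

THE PROOF (all inputs tree theorems, standard axioms, THESES-FREE imports): the stub's text is VERBATIM the body of the route item μ♭
`AnalyticMuFlatCMTwoRankZero` (stmt-BirchSwinnertonDyer-26470), which the tree reduces to the curve-free node (G′)_N at every odd level `N`:
`Theorems.analyticMuFlatNonUnitCMTwo_of_cuspSpan_all` (tp2-p2 g5, `…SignedMainConjectureCMTwoRankZeroFlatOfCuspSpan`) =
`SignedMuAtTwo.flatAtTwo_of_cuspSpan` ((G′)_{N_A} ⟹ `2 ∤ L♭` for every Pollack pair at `2` of the newform of a globally minimal `A` good
supersingular at `2` with `a₂ = 0`) ∘ `exists_isUnit_coeff_of_not_C_two_dvd`; and (G′)_N holds at EVERY odd level by the row induction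
`SignedMuAtTwo.Rows.cuspSpanEvenAtTwo_of_not_two_dvd` (rtt-p3-w2 g5, p643326, `…CuspSpanRowInductionOdd`; the `3 ∤ N` case is rtt-p3-w4 g2's
`cuspSpanEvenAtTwo_odd_of_not_three_dvd`, p642344), read through `SignedMuAtTwo.cuspSpanEvenAtTwo_iff` — the same composition as the node closer
`Theorems.CuspSpanEvenAtTwoOdd_proof` (item 27436, CLOSED 2026-08-28T15:07Z, p643713) and the glue
`AnalyticMuFlatAtTwo.analyticMuFlatCMTwoRankZero_of_cuspSpanEvenAtTwoOdd` (bsd-tp2-w7 g0, p643522), without importing the route file.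
The CM / analytic-rank / zone binders of the stub are carried, not used. The 26470 closer of the `cuspspan` line (LEAD bsd-tp2-w6 g0) is a
different declaration on a different item; this file neither restates nor pre-empts it.

References: Pollack, Duke Math. J. 118 (2003), Conj. 6.3, Prop. 6.18 [Pollack2003]; Kobayashi, Invent. Math. 152 (2003), Thm. 1.2, (3.6)
[Kobayashi2003]; Kurihara–Otsuki (2006), Rem. 0.2 (3) [KuriharaOtsuki2006]; Mazur–Tate–Teitelbaum, Invent. Math. 84 (1986), §I.8
[MazurTateTeitelbaum1986Invent]; Manin (1972) §1.5 [Manin1972].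
-/

set_option autoImplicit false
-- the Cruxes namespace of this sub repeats the summit name by design (D-0017 nested layout)
set_option linter.dupNamespace false

noncomputable section

open scoped Classical NumberField MatrixGroups ModularForm

open NumberField IsDedekindDomain CongruenceSubgroup WeierstrassCurve Literature Literature.NumberTheory.EllipticCurves
  Literature.NumberTheory.GaloisRepresentations Literature.NumberTheory.EllipticCurves.ModularForms
  Literature.NumberTheory.EllipticCurves.Rank1Residual Literature.NumberTheory.EllipticCurves.IwasawaDual
  Literature.NumberTheory.EllipticCurves.Kobayashi2003
  ZpExtension Summit.BirchSwinnertonDyer.Rank1Residual.Supersingular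

namespace Summit.BirchSwinnertonDyer.BirchSwinnertonDyer.Cruxes.SignedMainConjectureCMTwoRankZeroOfPub.RankZero

/-- **Registered stub `stub_analyticMuFlatNonUnitCMTwo` of line `rankzero` v15 — (μ♭)_A off the unit zone — PROVED.** For every CM curve
`A/ℚ` of analytic rank `0`, good supersingular at `2` with `a₂(A) = 0` and `2 ∣ #Ш(A)·∏c_ℓ(A)`, every newform `f` of `A` and every Pollack
pair `(L⁺, L⁻)` of `f` at `2`, Kobayashi's `L♭ = kobayashiL 1 L⁺ L⁻` has a unit coefficient (`μ(L♭) = 0`; Pollack 2003 Conj. 6.3 at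
`p = 2` for these forms). Proof: `Theorems.analyticMuFlatNonUnitCMTwo_of_cuspSpan_all` over the node (G′)_N at every odd level
(`SignedMuAtTwo.Rows.cuspSpanEvenAtTwo_of_not_two_dvd`, read through `SignedMuAtTwo.cuspSpanEvenAtTwo_iff`; module docstring).
[cite: Pollack2003, Conj. 6.3 and Prop. 6.18] [cite: Kobayashi2003, Thm. 1.2 and (3.6)] [cite: KuriharaOtsuki2006, Rem. 0.2 (3)] -/
theorem stub_analyticMuFlatNonUnitCMTwo :
    ∀ (A : WeierstrassCurve ℚ) [A.IsElliptic] [A.IsGloballyMinimal],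
      A.HasCM → A.analyticRank = 0 → GoodSS A 2 → A.frobeniusTrace 2 = 0 →
      2 ∣ A.shaOrder * A.tamagawaProduct →
      ∀ [NeZero (A.conductorNorm ℤ)] (f : CuspForm (Gamma0 (A.conductorNorm ℤ)) 2),
      IsNewformOf A f → ∀ (Lplus Lminus : IwasawaAlgebra 2), IsPollackPair f 2 Lplus Lminus →
        ∃ n : ℕ, IsUnit (PowerSeries.coeff n (kobayashiL 1 Lplus Lminus)) :=
  Summit.BirchSwinnertonDyer.BirchSwinnertonDyer.Theorems.analyticMuFlatNonUnitCMTwo_of_cuspSpan_all fun N _ h2 ↦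
    (Summit.BirchSwinnertonDyer.BirchSwinnertonDyer.Theorems.SignedMuAtTwo.cuspSpanEvenAtTwo_iff N).mp
      (Summit.BirchSwinnertonDyer.BirchSwinnertonDyer.Theorems.SignedMuAtTwo.Rows.cuspSpanEvenAtTwo_of_not_two_dvd N h2)

end Summit.BirchSwinnertonDyer.BirchSwinnertonDyer.Cruxes.SignedMainConjectureCMTwoRankZeroOfPub.RankZero

end
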